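import Summits.Ventures.CertifiedArithmetic.LowPrec.DoubleRoundingFMAMatrix

/-!
# Where an FMA slip can sit: the two windows, and the CLOSED window clause (all records)

HONEST FRAMING: certified error envelopes and provably optimal rounding/accumulation schemes for
low-precision formats under stated cost models; every table by two implementations; no hardware
or vendor claims.

`DoubleRoundingFMA.lean` proves THEOREM D-fma (`dFma_of_windows`): under `F_φ ⊆ F_ψ`,
`P_ψ ≥ 2 P_φ`, `bias φ ≤ bias ψ`, `L_ψ ≤ 2 L_φ`, `L_ψ + P_ψ ≤ L_φ`, a slip of `fl_φ ∘ fl_ψ` on an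
exact `a·b + c` needs the wide result in WINDOW A (`≥ 2^P_ψ` quanta of `φ`: the coarse-product
branch) or — only when `P_ψ < 3 P_φ` — in WINDOW B (`≥ 2^(P_ψ + 2 L_φ)`: the fine-product branch),
and concludes `DFma φ ψ` from the OPEN range conditions `M_φ < 2^P_ψ`, `maxRat φ < 2^(P_ψ + 2 L_φ)`.
This file separates the two steps, with the same proof (the integer core `fma_slip_core`):

* `slip_in_windows` — THE LOCALISATION: for positive data with a nonzero product and
  `x = a·b + c > 0`, if `fl_φ (fl_ψ x) ≠ fl_φ x` then `y = fl_ψ x` (a midpoint of `φ`) satisfies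
  `y < maxRat φ` and (`y ≥ 2^P_ψ · quantum φ` or (`P_ψ < 3 P_φ` and `y ≥ 2^(P_ψ + 2 L_φ)`));
* `dFma_pos_le`, `dFma_of_windows_le` — THE CLOSED WINDOW CLAUSE: `M_φ ≤ 2^P_ψ` and
  (`P_ψ ≥ 3 P_φ` or `maxRat φ ≤ 2^(P_ψ + 2 L_φ)`) already give `DFma φ ψ` (a midpoint of `φ` below
  `maxRat φ` is never the window's left end-point, a power of two).  The boundary matters: on the
  middle columns `2 P_φ ≤ P_ψ ≤ 3 P_φ - 2` the threshold `maxRat φ ≤ 2^(P_ψ + 2 L_φ)` is EXACT for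
  every source precision `P_φ ≤ 12` (`DoubleRoundingFMAMiddle.lean`, THEOREM D-fma-M), and a
  record whose top value is the power of two `2^(P_ψ + 2 L_φ)` itself is innocuous.

Implementation A: `code/enum/fma_middle_law.py` → `DOUBLE-ROUNDING-FMA.md` §13,
`certs/enum/DOUBLE-ROUNDING-FMA-MIDDLE.json`.  PLACEMENT as in `DoubleRoundingFMA.lean`
([Figueroa1995] §3, [Roux2014] §2 for `+ - × ÷ √`; [BoldoMelquiond2008] Thm 3 for the FMA by
rounding to odd); the localisation is the module docstring's anatomy of that file made a theorem.
No hardware or vendor claims.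
-/

namespace Summit.Ventures.CertifiedArithmetic

open Literature.ComputerArithmetic.FloatingPoint
open Literature.ComputerArithmetic.FloatingPoint.Format
open Literature.ComputerArithmetic.FloatingPoint.MiniFloat

/-! ## §1 The localisation of a slip -/

/-- THE TWO WINDOWS.  Under the grid conditions of THEOREM D-fma (`F_φ ⊆ F_ψ`, `P_ψ ≥ 2 P_φ`,
`bias φ ≤ bias ψ`, `L_ψ ≤ 2 L_φ`, `L_ψ + P_ψ ≤ L_φ`), a slip of `fl_φ ∘ fl_ψ` at `x = a·b + c > 0`
(`a`, `b` nonzero) forces the wide result `y = fl_ψ x` — a midpoint of `φ` — below `maxRat φ` and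
into WINDOW A (`y ≥ 2^P_ψ · quantum φ`) or, when `P_ψ < 3 P_φ`, into WINDOW B
(`y ≥ 2^(P_ψ + 2 L_φ)`).  The anatomy of `DoubleRoundingFMA.lean`, concluded one step earlier.
[this packet] -/
theorem slip_in_windows {φ ψ : Format} (hE : embedsTest φ ψ = true)
    (hm : 2 * φ.manBits + 1 ≤ ψ.manBits) (hb : φ.bias ≤ ψ.bias) (hq2 : ψ.qexp ≤ 2 * φ.qexp)
    (hnorm : ψ.qexp + ψ.manBits + 1 ≤ φ.qexp) {a b c : MiniFloat φ} (ha : a.scaledMag ≠ 0)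
    (hb0 : b.scaledMag ≠ 0) (hx : 0 < a.toRat * b.toRat + c.toRat)
    (h : (roundNE φ (roundNE ψ (a.toRat * b.toRat + c.toRat)).toRat).toRat
      ≠ (roundNE φ (a.toRat * b.toRat + c.toRat)).toRat) :
    (roundNE ψ (a.toRat * b.toRat + c.toRat)).toRat < φ.maxRat ∧
      ((2:ℚ) ^ (ψ.manBits + 1) * φ.quantum ≤ (roundNE ψ (a.toRat * b.toRat + c.toRat)).toRat ∨
        (ψ.manBits + 1 < 3 * (φ.manBits + 1) ∧
          (2:ℚ) ^ ((ψ.manBits : ℤ) + 1 + 2 * φ.qexp)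
            ≤ (roundNE ψ (a.toRat * b.toRat + c.toRat)).toRat)) := by
  set x := a.toRat * b.toRat + c.toRat with hxdef
  have hQφ := φ.quantum_pos; have hQ := ψ.quantum_pos
  have hq : ψ.qexp ≤ φ.qexp := by omega
  obtain ⟨zM, hzM⟩ := exists_toRat_eq_maxRat_of_test hE
  have hmax : φ.maxRat ≤ ψ.maxRat := hzM ▸ (le_abs_self _).trans (abs_toRat_le_maxRat zM)
  -- the slip anatomy in `φ`: `fl_ψ x = m = (v+u)/2`, `u = v + G`
  obtain ⟨v, u, hv0, hvx, hxu, hgap, hmid, hxm⟩ := slip_midpoint_of_pos (by omega) hb hmax hx h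
  set y := roundNE ψ x with hydef
  obtain ⟨u', hu'⟩ := exists_toRat_eq_add_ulp hv0 (hvx.trans hxu)
  have hule := add_ulp_le_of_lt hv0 (hvx.trans hxu)
  have hGpos : (0:ℚ) < 2 ^ (v.expCode - 1) * φ.quantum := by positivity
  have hueq : u.toRat = v.toRat + 2 ^ (v.expCode - 1) * φ.quantum := by
    rcases hgap u' with h1 | h1 <;> linarith
  have hutop : u.toRat ≤ 2 ^ (φ.manBits + 1 + (v.expCode - 1)) * φ.quantum :=
    hueq ▸ toRat_add_ulp_le hv0
  have humax : u.toRat ≤ φ.maxRat := (le_abs_self _).trans (abs_toRat_le_maxRat u)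
  have hyu : y.toRat < u.toRat := by rw [hmid]; linarith
  have hy0 : 0 ≤ y.toRat := by rw [hmid]; linarith
  refine ⟨lt_of_lt_of_le hyu humax, ?_⟩
  by_contra hcon
  simp only [not_or, not_and, not_le] at hcon
  obtain ⟨hyA, hyB⟩ := hcon
  -- quanta: `quantum φ = 2^D quantum ψ`, `quantum φ² = 2^S quantum ψ`, `ν = quantum ψ / 2`
  set D := (φ.qexp - ψ.qexp).toNat with hDdef
  have hDq : φ.quantum = 2 ^ D * ψ.quantum := quantum_eq_two_pow_mul hq
  have hD1 : ψ.manBits + 1 ≤ D := by omega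
  set S := (2 * φ.qexp - ψ.qexp).toNat with hSdef
  have hS0 : ((S : ℕ) : ℤ) = 2 * φ.qexp - ψ.qexp := by
    rw [hSdef]; exact Int.toNat_of_nonneg (by omega)
  have hSq : φ.quantum * φ.quantum = 2 ^ S * ψ.quantum := by
    unfold Format.quantum
    rw [← zpow_natCast, ← zpow_add₀ two_ne_zero, ← zpow_add₀ two_ne_zero, hS0]
    congr 1; ring
  set ν : ℚ := ψ.quantum / 2 with hνdef
  have hν : 0 < ν := by positivity
  have hQν : ψ.quantum = 2 * ν := by rw [hνdef]; ring
  -- the integers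
  have hyQ : y.toRat = (y.scaledMag : ℚ) * ψ.quantum := by
    rw [toRat_eq_toInt_mul, toInt_eq_scaledMag_of_nonneg hy0]; push_cast; rfl
  have hvQ : v.toRat = (v.scaledMag : ℚ) * φ.quantum := by
    rw [toRat_eq_toInt_mul, toInt_eq_scaledMag_of_nonneg hv0]; push_cast; rfl
  obtain ⟨V', hV'⟩ := pow_ulpExp_dvd_scaledMag v
  set g := (v.expCode - 1) + D with hgdef
  set M : ℤ := 2 * (y.scaledMag : ℤ) with hMdef
  have hmν : y.toRat = (M : ℚ) * ν := by rw [hyQ, hMdef, hQν]; push_cast; ring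
  have hGν : 2 ^ (v.expCode - 1) * φ.quantum = 2 * (2:ℚ) ^ g * ν := by
    rw [hDq, hQν, hgdef, pow_add]; ring
  have hMg : M = (2 * (V' : ℤ) + 1) * 2 ^ g := by
    have h1 : (M : ℚ) * ν = ((2 * (V' : ℤ) + 1) * 2 ^ g : ℤ) * ν := by
      rw [← hmν, hmid, hueq, hvQ, hV', hGν, hDq, hQν, hgdef]
      push_cast; ring
    exact_mod_cast mul_right_cancel₀ (ne_of_gt hν) h1
  -- the result is normal in `ψ`: `expCode ≥ 1`
  have hE1 : 1 ≤ y.expCode := by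
    by_contra h0
    have h0 : y.expCode = 0 := by omega
    have hlt : y.scaledMag < 2 ^ ψ.manBits := by
      have := y.man_lt; unfold scaledMag; rw [h0, Format.scaled_zero]; exact this
    have h1 : φ.quantum ≤ 2 ^ (v.expCode - 1) * φ.quantum :=
      le_mul_of_one_le_left hQφ.le (one_le_pow₀ (by norm_num))
    have h2 : (2:ℚ) ^ D * ψ.quantum ≤ (2 * y.scaledMag : ℚ) * ψ.quantum := by
      rw [← hDq, mul_assoc, ← hyQ, hmid, hueq]; linarith
    have h3 : (2 ^ D : ℕ) ≤ 2 * y.scaledMag := by exact_mod_cast le_of_mul_le_mul_right h2 hQ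
    have h4 : 2 ^ (ψ.manBits + 1) ≤ 2 ^ D := Nat.pow_le_pow_right (by norm_num) hD1
    rw [pow_succ] at h4; omega
  set t := y.expCode - 1 with htdef
  have hSy_lo : 2 ^ (ψ.manBits + t) ≤ y.scaledMag := pow_le_scaledMag_of_expCode_pos y hE1
  -- (a) correct rounding in `ψ`: `|x - m| ≤ 2^t ν`
  have hyz : y.toRat < zM.toRat := by rw [hzM]; linarith
  have habs : |x - y.toRat| ≤ 2 ^ t * ν := by
    have := abs_sub_roundNE_le_half_ulp hy0 hyz hE1
    rw [← hydef, hQν] at this; convert this using 1; rw [htdef]; ring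
  -- `x = (P + C) ν`, `c = C ν`
  set P : ℤ := a.toInt * b.toInt * 2 ^ (S + 1) with hPdef
  set C : ℤ := c.toInt * 2 ^ (D + 1) with hCdef
  have hxν : x = ((P + C : ℤ) : ℚ) * ν := by
    calc x = (a.toInt * b.toInt : ℚ) * (φ.quantum * φ.quantum) + c.toInt * φ.quantum := by
          rw [hxdef, toRat_eq_toInt_mul, toRat_eq_toInt_mul, toRat_eq_toInt_mul]; ring
      _ = (a.toInt * b.toInt : ℚ) * (2 ^ S * (2 * ν)) + c.toInt * (2 ^ D * (2 * ν)) := by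
          rw [hSq, hDq, hQν]
      _ = ((P + C : ℤ) : ℚ) * ν := by rw [hPdef, hCdef]; push_cast; ring
  have hcν : c.toRat = (C : ℚ) * ν := by
    rw [toRat_eq_toInt_mul, hCdef, hDq, hQν]; push_cast; ring
  -- `N = P + C - M ≠ 0`, `|N| ≤ 2^t`
  have hN0 : P + C - M ≠ 0 := by
    intro h0; apply hxm; rw [hxν, hmν]; congr 1; exact_mod_cast (sub_eq_zero.mp h0)
  have hNle : |P + C - M| ≤ (2:ℤ) ^ t := by
    have h1 : (|((P + C - M : ℤ) : ℚ)|) * ν ≤ (2:ℚ) ^ t * ν := by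
      rw [← abs_of_pos hν, ← abs_mul, abs_of_pos hν]
      have e : ((P + C - M : ℤ) : ℚ) * ν = x - y.toRat := by rw [hxν, hmν]; push_cast; ring
      rw [e]; exact habs
    exact_mod_cast le_of_mul_le_mul_right h1 hν
  -- `v = (M - 2^g) ν`, `u = (M + 2^g) ν`, hence `|C - M| ≥ 2^g`
  have hvν : v.toRat = ((M : ℚ) - 2 ^ g) * ν := by
    have e : v.toRat = y.toRat - 2 ^ (v.expCode - 1) * φ.quantum / 2 := by rw [hmid, hueq]; ring
    rw [e, hmν, hGν]; ring
  have huν : u.toRat = ((M : ℚ) + 2 ^ g) * ν := by rw [hueq, hvν, hGν]; ring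
  have hfar : (2:ℤ) ^ g ≤ |C - M| := by
    rcases hgap c with h1 | h1
    · rw [hcν, hvν] at h1
      have h3 : (C : ℤ) ≤ M - 2 ^ g := by exact_mod_cast le_of_mul_le_mul_right h1 hν
      rw [abs_sub_comm]; exact le_trans (by linarith) (le_abs_self _)
    · rw [hcν, huν] at h1
      have h3 : M + 2 ^ g ≤ (C : ℤ) := by exact_mod_cast le_of_mul_le_mul_right h1 hν
      exact le_trans (by linarith) (le_abs_self _)
  -- binade bookkeeping: `2^(m_ψ + t + 1) ≤ M < 2^(m_φ + 1 + g + 1)`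
  have hMlt : M < (2:ℤ) ^ (φ.manBits + 1 + g + 1) := by
    have h1 : (M : ℚ) * ν < (2:ℚ) ^ (φ.manBits + 1 + g + 1) * ν := by
      rw [← hmν]
      calc y.toRat < u.toRat := hyu
        _ ≤ 2 ^ (φ.manBits + 1 + (v.expCode - 1)) * φ.quantum := hutop
        _ = (2:ℚ) ^ (φ.manBits + 1 + g + 1) * ν := by
            rw [hDq, hQν, hgdef]; simp only [pow_add, pow_one]; ring
    exact_mod_cast lt_of_mul_lt_mul_right h1 hν.le
  have hMge : (2:ℤ) ^ (ψ.manBits + t + 1) ≤ M := by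
    have h1 : ((2 ^ (ψ.manBits + t) : ℕ) : ℤ) ≤ y.scaledMag := by exact_mod_cast hSy_lo
    push_cast at h1
    rw [hMdef, pow_succ]; linarith
  have hexp : ψ.manBits + t < φ.manBits + 1 + g := by
    have := (pow_lt_pow_iff_right₀ (by norm_num : (1:ℤ) < 2)).mp (hMge.trans_lt hMlt); omega
  have htg : t < g := by omega
  -- `y` below WINDOW A ⇒ `t < D + 1`
  have htD : t < D + 1 := by
    have h1 : (M : ℚ) * ν < (2:ℚ) ^ (ψ.manBits + 1 + D + 1) * ν := by
      rw [← hmν]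
      calc y.toRat < (2:ℚ) ^ (ψ.manBits + 1) * φ.quantum := hyA
        _ = (2:ℚ) ^ (ψ.manBits + 1 + D + 1) * ν := by
            rw [hDq, hQν]; simp only [pow_add, pow_one]; ring
    have h2 : M < (2:ℤ) ^ (ψ.manBits + 1 + D + 1) := by
      exact_mod_cast lt_of_mul_lt_mul_right h1 hν.le
    have := (pow_lt_pow_iff_right₀ (by norm_num : (1:ℤ) < 2)).mp (hMge.trans_lt h2); omega
  -- `P_ψ ≥ 3 P_φ`, or `y` below WINDOW B ⇒ `t + 2 P_φ ≤ g ∨ t < S + 1`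
  have hB : t + 2 * (φ.manBits + 1) ≤ g ∨ t < S + 1 := by
    rcases Nat.lt_or_ge (ψ.manBits + 1) (3 * (φ.manBits + 1)) with h3 | h3
    swap
    · left; omega
    · right
      have h1 : (M : ℚ) * ν < (2:ℚ) ^ (ψ.manBits + 1 + S + 1) * ν := by
        rw [← hmν]
        calc y.toRat < (2:ℚ) ^ ((ψ.manBits : ℤ) + 1 + 2 * φ.qexp) := hyB h3
          _ = (2:ℚ) ^ (ψ.manBits + 1 + S + 1) * ν := by
              rw [hνdef]; unfold Format.quantum
              have e : (ψ.manBits : ℤ) + 1 + 2 * φ.qexp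
                  = (((ψ.manBits + 1 + S + 1 : ℕ) : ℤ) - 1) + ψ.qexp := by
                push_cast; rw [hS0]; ring
              rw [e, zpow_add₀ two_ne_zero, zpow_sub₀ two_ne_zero, zpow_natCast, zpow_one]; ring
      have h2 : M < (2:ℤ) ^ (ψ.manBits + 1 + S + 1) := by
        exact_mod_cast lt_of_mul_lt_mul_right h1 hν.le
      have := (pow_lt_pow_iff_right₀ (by norm_num : (1:ℤ) < 2)).mp (hMge.trans_lt h2); omega
  -- the product: `2^k ∥ P`, `|P| ≤ (2^P_φ - 1)² 2^k`, `k ≥ S + 1`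
  obtain ⟨αa, a₁, ha₁, haα, ha₁lt⟩ := exists_odd_part a ha
  obtain ⟨αb, b₁, hb₁, hbα, hb₁lt⟩ := exists_odd_part b hb0
  set k := αa + αb + (S + 1) with hkdef
  have h2w : ∀ i : ℕ, ((2:ℤ) ^ i).natAbs = 2 ^ i := fun i => by rw [Int.natAbs_pow]; rfl
  have hPabs : P.natAbs = 2 ^ k * (a₁ * b₁) := by
    rw [hPdef, Int.natAbs_mul, Int.natAbs_mul, natAbs_toInt, natAbs_toInt, h2w, haα, hbα, hkdef]
    simp only [pow_add]; ring
  have hkP : (2:ℤ) ^ k ∣ P := by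
    rw [← Int.natAbs_dvd_natAbs, h2w, hPabs]; exact Dvd.intro _ rfl
  have hkP' : ¬ (2:ℤ) ^ (k + 1) ∣ P := by
    intro hd
    have h1 := Int.natAbs_dvd_natAbs.mpr hd
    rw [h2w, hPabs, pow_succ] at h1
    exact (Nat.odd_mul.mpr ⟨ha₁, hb₁⟩).not_two_dvd_nat
      (Nat.dvd_of_mul_dvd_mul_left (by positivity) h1)
  have hPle : |P| ≤ ((2:ℤ) ^ (φ.manBits + 1) - 1) ^ 2 * 2 ^ k := by
    rw [Int.abs_eq_natAbs, hPabs]; push_cast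
    have h1 : (a₁ : ℤ) + 1 ≤ 2 ^ (φ.manBits + 1) := by exact_mod_cast ha₁lt
    have h2 : (b₁ : ℤ) + 1 ≤ 2 ^ (φ.manBits + 1) := by exact_mod_cast hb₁lt
    have h12 : (a₁ : ℤ) * b₁ ≤ (2 ^ (φ.manBits + 1) - 1) ^ 2 := by
      rw [sq]; exact mul_le_mul (by linarith) (by linarith) (by positivity) (by linarith)
    rw [mul_comm]; exact mul_le_mul_of_nonneg_right h12 (by positivity)
  have hCγ : (2:ℤ) ^ (D + 1) ∣ C := by rw [hCdef]; exact dvd_mul_left _ _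
  have hB' : t + 2 * (φ.manBits + 1) ≤ g ∨ t < k := hB.imp_right (fun h => by omega)
  exact fma_slip_core (by omega) hkP hkP' hPle hCγ htD hMg htg hN0 hNle hfar hB'

/-! ## §2 The closed window clause -/

/-- THEOREM D-fma with CLOSED windows, positive inputs with a nonzero product: `M_φ ≤ 2^P_ψ` and
(`P_ψ ≥ 3 P_φ` or `maxRat φ ≤ 2^(P_ψ + 2 L_φ)`) exclude the slip (`dFma_pos` has `<` twice).
[this packet] -/
theorem dFma_pos_le {φ ψ : Format} (hE : embedsTest φ ψ = true)
    (hm : 2 * φ.manBits + 1 ≤ ψ.manBits) (hb : φ.bias ≤ ψ.bias) (hq2 : ψ.qexp ≤ 2 * φ.qexp)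
    (hnorm : ψ.qexp + ψ.manBits + 1 ≤ φ.qexp) (hwinA : φ.maxScaled ≤ 2 ^ (ψ.manBits + 1))
    (hwinB : 3 * (φ.manBits + 1) ≤ ψ.manBits + 1 ∨
      φ.maxRat ≤ (2:ℚ) ^ ((ψ.manBits : ℤ) + 1 + 2 * φ.qexp))
    {a b c : MiniFloat φ} (ha : a.scaledMag ≠ 0) (hb0 : b.scaledMag ≠ 0)
    (hx : 0 < a.toRat * b.toRat + c.toRat) :
    (roundNE φ (roundNE ψ (a.toRat * b.toRat + c.toRat)).toRat).toRat
      = (roundNE φ (a.toRat * b.toRat + c.toRat)).toRat := by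
  by_contra h
  obtain ⟨hymax, hwin⟩ := slip_in_windows hE hm hb hq2 hnorm ha hb0 hx h
  have hA : φ.maxRat ≤ (2:ℚ) ^ (ψ.manBits + 1) * φ.quantum := by
    unfold Format.maxRat
    exact mul_le_mul_of_nonneg_right (by exact_mod_cast hwinA) φ.quantum_pos.le
  rcases hwin with hyA | ⟨h3, hyB⟩
  · exact absurd (hymax.trans_le hA) (not_lt.mpr hyA)
  · rcases hwinB with h3' | hB
    · omega
    · exact absurd (hymax.trans_le hB) (not_lt.mpr hyB)

/-- THEOREM D-fma, THE CLOSED WINDOW CLAUSE, every pair of format records: `F_φ ⊆ F_ψ`,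
`P_ψ ≥ 2 P_φ`, `bias_φ ≤ bias_ψ`, `L_ψ ≤ 2 L_φ`, `L_ψ + P_ψ ≤ L_φ`, `M_φ ≤ 2^P_ψ` and
(`P_ψ ≥ 3 P_φ` or `maxRat φ ≤ 2^(P_ψ + 2 L_φ)`) imply `DFma φ ψ`.  `dFma_of_windows` is the case of
strict inequalities; the boundary records (top value a power of two at a window's end-point) are
new. [this packet] -/
theorem dFma_of_windows_le {φ ψ : Format} (hE : embedsTest φ ψ = true)
    (hm : 2 * φ.manBits + 1 ≤ ψ.manBits) (hb : φ.bias ≤ ψ.bias) (hq2 : ψ.qexp ≤ 2 * φ.qexp)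
    (hnorm : ψ.qexp + ψ.manBits + 1 ≤ φ.qexp) (hwinA : φ.maxScaled ≤ 2 ^ (ψ.manBits + 1))
    (hwinB : 3 * (φ.manBits + 1) ≤ ψ.manBits + 1 ∨
      φ.maxRat ≤ (2:ℚ) ^ ((ψ.manBits : ℤ) + 1 + 2 * φ.qexp)) : DFma φ ψ := by
  intro a b c
  by_cases hab : a.scaledMag = 0 ∨ b.scaledMag = 0
  · have h0 : a.toRat * b.toRat = 0 := by
      rcases hab with h0 | h0 <;>
        simp [toRat_eq_toInt_mul a, toRat_eq_toInt_mul b, MiniFloat.toInt, h0]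
    rw [h0, zero_add]
    exact toRat_roundNE_roundNE_of_exists (embeds_of_test hE c)
  simp only [not_or] at hab
  rcases lt_trichotomy (a.toRat * b.toRat + c.toRat) 0 with hneg | h0 | hpos
  · have h := dFma_pos_le hE hm hb hq2 hnorm hwinA hwinB (a := a.flipSign) (b := b)
      (c := c.flipSign) hab.1 hab.2 (by simp only [toRat_flipSign]; linarith)
    simp only [toRat_flipSign] at h
    have e : -a.toRat * b.toRat + -c.toRat = -(a.toRat * b.toRat + c.toRat) := by ring
    rwa [e, toRat_roundNE_neg, toRat_roundNE_neg, toRat_roundNE_neg, neg_inj] at h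
  · simp only [h0, toRat_roundNE_zero]
  · exact dFma_pos_le hE hm hb hq2 hnorm hwinA hwinB hab.1 hab.2 hpos

end Summit.Ventures.CertifiedArithmetic
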